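import Summits.HodgeConjecture.HodgeConjecture.Theorems.Ring2TransportLocalGermCMField
import Literature.AlgebraicGeometry.HodgeTheory.WeilClassesFieldRationalSpan
import Literature.AlgebraicGeometry.HodgeTheory.WeilClassesMoonenZarhinCriterionHolds
import HarnessLib

/-!
# Ring-2 transport, gen 5 (μ): row T6-CM in CLOSED FORM — Moonen–Zarhin's criterion and the descent input DISCHARGED

HONEST FRAMING (page 1, verbatim for the cell). Everything in this file is a RESEARCH ROUTE CONDITIONAL ON `HC_CM`
(`Theses.RankFourFaces.CMAbelianHodge`, an explicit binder `hCM`, never a fact); NOT a corollary of anything in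
print; Question 11.4 SENTENCE 2 of Markman's survey (the weak semiregularity criterion) is ALREADY REFUTED in
dimension ≥ 3 (`SemiregularityWeakCriterionAbelianCounterexample`, `…Full`) and is used nowhere below. The preprints
[M] arXiv:2502.03415, [S] arXiv:2509.23403, [C] arXiv:2509.23079, [P] arXiv:2604.00511 are UNREFEREED (statements
only, never inputs). No internally-minted statement is cited as a fact; every open input below is an explicit
hypothesis, labelled ours/open.

WHAT THIS FILE DOES. Gen 5's row T6-CM (`Theorems/Ring2TransportWeilTypeGeneralCMFieldSU.lean`: the Hodge conjecture
for every GENERAL abelian variety of Weil type with respect to an arbitrary CM field `E`, `[E:ℚ] = 2e₀ ≥ 4` — the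
class target `HodgeGeneralWeilTypeCMField`, Deligne's endnote = fact #24) carried two literature-side binders that are
now KERNEL THEOREMS of the Literature library:
* `(hMZ : MoonenZarhin1998_weilClasses_hodgeCriterion)` — PROVED on the carriers:
  `HodgeTheory.MoonenZarhin1998_weilClasses_hodgeCriterion_holds` (`WeilClassesMoonenZarhinCriterionHolds.lean`);
* `(hQ : WeilClassesFieldRationallySpanned)` (descent of `W_E ⊗ ℂ` to its rational classes) — PROVED in the
  irreducible instance the row uses: `HodgeTheory.weilClassesField_le_span_isRationalClass`
  (`WeilClassesFieldRationalSpan.lean`; for a Weil-type carrier `IsWeilTypeCM A η R e₀ k` the hypotheses are the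
  structure fields `irreducible`, `eval₂_eq_zero`).
This file feeds both theorems in and records every T6-CM row of the cell WITHOUT those binders ("closed form"). After
this, the input list of row T6-CM reads, honestly: `HC_CM` (binder; NOMINAL — see the divisor-generated twins, whose
anchor leaf is gen 2's ANCHOR-GOOD hypothesis for `[E:ℚ] > 2`) · ONE anchor-supply leaf (ours/open:
`CMPointedWeilFamiliesCMField` or `DivisorGeneratedCMPointedWeilFamiliesCMField`) · ONE transport leaf (ours/open, from
strongest to weakest: R3var `WeilVariationalHodgeCMField` ⟸ the local germ at CM fibres `LocalWeilVHCAtCMField` ⟸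
the semiregular Chern lift `SemiregularChernLiftAtCMField C` + Buchweitz–Flenner 2003 Thm. 5.1 (REFEREED, unformalised
named fact)) · fact #24 `Deligne1982_hodgeRing_weilTypeCM_of_hodgeGroupSU` (Deligne's endnote: `MT = Hg = SU ⟹` Hodge
ring generated by divisors and Weil classes — UNREFEREED at both loci: Milne's 2003 TeXing of Deligne 1982, endnote 16;
Milne 2025, Ex. 1.17). Fact #24 is now the ONLY unformalised literature input of the row besides Buchweitz–Flenner on
the germ rows.

Rows (all `HodgeGeneralWeilTypeCMField`-valued unless said otherwise):
* `hodgeConjectureFor_weilTypeCM_closed` — one general Weil-type `(A, η)`: #24 + Rosati/SU/polarisation data + "its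
  rational Weil classes are algebraic" ⟹ `HodgeConjectureFor A.dim A.X` (every `e₀ ≥ 1`).
* `hodgeGeneralWeilTypeCMField_of_weilClassesCMField_closed : (#24) → R3 → T6-CM` and the converse on general members
  `mem_algebraicClasses_general_of_hodgeGeneralWeilTypeCMField_closed` (T6-CM ⟹ R3|general, no binder left).
* `HC_GeneralWeilTypeCMField_of_HC_CM_closed : HC_CM → CMPointedWeilFamiliesCMField → WeilVariationalHodgeCMField →
  (#24) → T6-CM`; `…_local_closed` (local germ at CM fibres instead of R3var); `…_of_semiregularChernLift_closed`
  (Chern lift + BF 2003); and the three `HC_CM`-FREE twins `…_of_divisorGeneratedCMPointed_closed / _local_closed /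
  _of_semiregularChernLift_closed`.
* `hodgeGeneralWeilTypeCMField_closed_position` — kernel-checked conjunction of the above shapes.
Not here (module not yet in the tree when this was written): the same discharge for the every-CM-field class
`HodgeGeneralWeilTypeEveryCMField` (`Theorems/Ring2TransportWeilTypeEveryCMField.lean`) — one line each over this file.

References (bib keys): Deligne1982HodgeCycles (§4 (4.4), Prop. 4.4, Thm. 4.8, §5, endnote 16), MoonenZarhin1998WeilClasses
(§1: `W_F ⊗ ℂ`, Lemma (1), Criterion), vanGeemen1994HodgeAV (4.9, 6.11–6.12), BuchweitzFlenner2003 (§5 Thm. 5.1),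
CharlesSchnell2014Notes (Conj. 11.3.1, Prop. 11.3.11), Gordon1997 (Thm. 6.4, §3), Milne2025HodgeNotes (Ex. 1.17,
unrefereed notes), Markman2025SurveySecant ([S] §12 — preprint / ICM 2026 lecture, unrefereed, statements only),
Andre2026 (arXiv:2601.21052 §4.4.4 — preprint, unrefereed, statement only).
-/

set_option linter.dupNamespace false

noncomputable section

open CategoryTheory

namespace Summit.HodgeConjecture.HodgeConjecture.Ring2Transport

open Literature.AlgebraicGeometry Literature.AlgebraicGeometry.Motives
open Literature.AlgebraicGeometry.HodgeTheory
open Literature.AlgebraicGeometry.Deligne1982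
open Literature.AlgebraicGeometry.VanGeemen1994 (pullbackOne hodgeClassSpan)
open Literature.AlgebraicTopology.SingularHomology
open Summit.HodgeConjecture.HodgeConjecture.Theses
open Summit.HodgeConjecture.HodgeConjecture.WeilTypeLadder

/-! ### §1 One general Weil-type abelian variety, closed form -/

/-- **HC for one general Weil-type `(A, η)` from fact #24 and the algebraicity of its RATIONAL Weil classes — Moonen–Zarhin
and the descent of `W_E ⊗ ℂ` fed in as theorems.** Gen 5's `hodgeConjectureFor_weilTypeCM_of_rational` with
`hMZ := MoonenZarhin1998_weilClasses_hodgeCriterion_holds` and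
`hQ := weilClassesField_le_span_isRationalClass hW.irreducible hW.eval₂_eq_zero (2k)`. Valid for every `e₀ ≥ 1`.
[cite: Deligne1982HodgeCycles, §4 (4.4), Prop. 4.4, endnote 16] [cite: MoonenZarhin1998WeilClasses, §1 (Lemma (1), Criterion)] -/
theorem hodgeConjectureFor_weilTypeCM_closed (h24 : Deligne1982_hodgeRing_weilTypeCM_of_hodgeGroupSU)
    {A : AbelianVariety ℂ} {η : A ⟶ A} {R : Polynomial ℤ} {e₀ k : ℕ} {h : complexBetti A.X 2}
    (hW : IsWeilTypeCM A η R e₀ k) (hpol : IsPolarizationClass A.dim A.X h)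
    (hRos : ∀ x y : complexBetti A.X 1,
      polarizationPairingOne A.X h (A.dim - 1) (pullbackOne A η x) y =
        -polarizationPairingOne A.X h (A.dim - 1) x (pullbackOne A η y))
    (hSU : HasHodgeGroupSUCM A η (R.comp (Polynomial.X ^ 2)) h)
    (hR : ∀ c ∈ weilClassesField A η (R.comp (Polynomial.X ^ 2)) (2 * k), IsRationalClass c →
      IsOfHodgeType A.dim A.X (2 * k) k k c → c ∈ algebraicClasses A.X k) :
    HodgeConjectureFor A.dim A.X :=
  hodgeConjectureFor_weilTypeCM_of_rational h24 MoonenZarhin1998_weilClasses_hodgeCriterion_holds hW hpol hRos hSU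
    (weilClassesField_le_span_isRationalClass hW.irreducible hW.eval₂_eq_zero (2 * k)) hR

/-! ### §2 (A) R3 ⟹ T6-CM and the converse on general members, closed form -/

/-- **`(#24) → R3 → HodgeGeneralWeilTypeCMField`** — gen 5's `hodgeGeneralWeilTypeCMField_of_weilClassesCMField` with
Moonen–Zarhin and the descent input discharged. [cite: Deligne1982HodgeCycles, §4 (4.4), Prop. 4.4, endnote 16]
[cite: MoonenZarhin1998WeilClasses, §1] -/
theorem hodgeGeneralWeilTypeCMField_of_weilClassesCMField_closed
    (h24 : Deligne1982_hodgeRing_weilTypeCM_of_hodgeGroupSU) (hR3 : WeilClassesCMField) : HodgeGeneralWeilTypeCMField :=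
  fun _ _ _ _ _ _ he hW hpol hRos hSU ↦
    hodgeConjectureFor_weilTypeCM_closed h24 hW hpol hRos hSU (weilClassesCMField_isWeilTypeCM hR3 he hW)

/-- **Conversely, T6-CM ⟹ R3 on general members, no binder left**: under `HodgeGeneralWeilTypeCMField` every RATIONAL
class of `W_E ⊗ ℂ` on a general Weil-type `(A, η)` with `e₀ ≥ 2` is algebraic (Moonen–Zarhin's criterion, now a
theorem, supplies the Hodge type). [cite: MoonenZarhin1998WeilClasses, §1 (Criterion)] [cite: Deligne2000, §1] -/
theorem mem_algebraicClasses_general_of_hodgeGeneralWeilTypeCMField_closed (hT : HodgeGeneralWeilTypeCMField)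
    {A : AbelianVariety ℂ} {η : A ⟶ A} {R : Polynomial ℤ} {e₀ k : ℕ} {h : complexBetti A.X 2} (he : 2 ≤ e₀)
    (hW : IsWeilTypeCM A η R e₀ k) (hpol : IsPolarizationClass A.dim A.X h)
    (hRos : ∀ x y : complexBetti A.X 1,
      polarizationPairingOne A.X h (A.dim - 1) (pullbackOne A η x) y =
        -polarizationPairingOne A.X h (A.dim - 1) x (pullbackOne A η y))
    (hSU : HasHodgeGroupSUCM A η (R.comp (Polynomial.X ^ 2)) h) {c : complexBetti A.X (2 * k)}
    (hc : c ∈ weilClassesField A η (R.comp (Polynomial.X ^ 2)) (2 * k)) (hcQ : IsRationalClass c) :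
    c ∈ algebraicClasses A.X k :=
  mem_algebraicClasses_general_of_hodgeGeneralWeilTypeCMField hT MoonenZarhin1998_weilClasses_hodgeCriterion_holds he
    hW hpol hRos hSU hc hcQ

/-! ### §3 The rows T6-CM / T6-CM-local / T6-CM-germ and their `HC_CM`-free twins, closed form -/

/-- **Row T6-CM, closed form: `HC_CM → CMPointedWeilFamiliesCMField → WeilVariationalHodgeCMField → (#24) →
HodgeGeneralWeilTypeCMField`.** [cite: Deligne1982HodgeCycles, §4, proof of Thm. 4.8 (a)–(c), §5, endnote 16]
[cite: CharlesSchnell2014Notes, Conj. 11.3.1] [cite: Markman2025SurveySecant, §12 (preprint / ICM 2026 lecture, unrefereed)] -/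
theorem HC_GeneralWeilTypeCMField_of_HC_CM_closed (hCM : Theses.RankFourFaces.CMAbelianHodge)
    (hP : CMPointedWeilFamiliesCMField) (hV : WeilVariationalHodgeCMField)
    (h24 : Deligne1982_hodgeRing_weilTypeCM_of_hodgeGroupSU) : HodgeGeneralWeilTypeCMField :=
  hodgeGeneralWeilTypeCMField_of_weilClassesCMField_closed h24 (HC_WeilClassesCMField_of_HC_CM hCM hP hV)

/-- **Row T6-CM-local, closed form: `HC_CM → CMPointedWeilFamiliesCMField → LocalWeilVHCAtCMField → (#24) →
HodgeGeneralWeilTypeCMField`** (the local germ at CM fibres instead of R3var; Baire + Charles–Schnell in the tree).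
[cite: CharlesSchnell2014Notes, Prop. 11.3.11 (proof)] [cite: BuchweitzFlenner2003, Thm. 5.1]
[cite: Deligne1982HodgeCycles, §4 (4.4), Prop. 4.4, endnote 16] -/
theorem HC_GeneralWeilTypeCMField_of_HC_CM_local_closed (hCM : Theses.RankFourFaces.CMAbelianHodge)
    (hP : CMPointedWeilFamiliesCMField) (hL : LocalWeilVHCAtCMField)
    (h24 : Deligne1982_hodgeRing_weilTypeCM_of_hodgeGroupSU) : HodgeGeneralWeilTypeCMField :=
  hodgeGeneralWeilTypeCMField_of_weilClassesCMField_closed h24 (HC_WeilClassesCMField_of_HC_CM_local hCM hP hL)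

/-- **Row T6-CM-germ, closed form: `HC_CM → CMPointedWeilFamiliesCMField → SemiregularChernLiftAtCMField C → BF2003 →
(#24) → HodgeGeneralWeilTypeCMField`** (literature inputs: Buchweitz–Flenner 2003 Thm. 5.1, REFEREED; fact #24,
UNREFEREED ×2). [cite: BuchweitzFlenner2003, §5 Thm. 5.1] [cite: Deligne1982HodgeCycles, §4 (4.4), Prop. 4.4, endnote 16] -/
theorem HC_GeneralWeilTypeCMField_of_HC_CM_of_semiregularChernLift_closed (C : ChernCharacterBetti)
    (hCM : Theses.RankFourFaces.CMAbelianHodge) (hP : CMPointedWeilFamiliesCMField)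
    (hL : SemiregularChernLiftAtCMField C) (hBF : BuchweitzFlenner2003_variationalHodge_ISemiregular)
    (h24 : Deligne1982_hodgeRing_weilTypeCM_of_hodgeGroupSU) : HodgeGeneralWeilTypeCMField :=
  hodgeGeneralWeilTypeCMField_of_weilClassesCMField_closed h24
    (HC_WeilClassesCMField_of_HC_CM_of_semiregularChernLift C hCM hP hL hBF)

/-- **Row T6-CM WITHOUT `HC_CM`, closed form: `DivisorGeneratedCMPointedWeilFamiliesCMField → WeilVariationalHodgeCMField
→ (#24) → HodgeGeneralWeilTypeCMField`** (load-bearing audit: `HC_CM` is NOMINAL on this row for anchor-good `E`).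
[cite: Gordon1997, Thm. 6.4 and §3 Theorem] [cite: Deligne1982HodgeCycles, §4 (4.4), Prop. 4.4, §5, endnote 16] -/
theorem HC_GeneralWeilTypeCMField_of_divisorGeneratedCMPointed_closed (hP : DivisorGeneratedCMPointedWeilFamiliesCMField)
    (hV : WeilVariationalHodgeCMField) (h24 : Deligne1982_hodgeRing_weilTypeCM_of_hodgeGroupSU) :
    HodgeGeneralWeilTypeCMField :=
  hodgeGeneralWeilTypeCMField_of_weilClassesCMField_closed h24 (HC_WeilClassesCMField_of_divisorGeneratedCMPointed hP hV)

/-- **Row T6-CM-local WITHOUT `HC_CM`, closed form.** [cite: Gordon1997, Thm. 6.4] [cite: CharlesSchnell2014Notes, Prop. 11.3.11 (proof)]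
[cite: Deligne1982HodgeCycles, §4 (4.4), Prop. 4.4, endnote 16] -/
theorem HC_GeneralWeilTypeCMField_of_divisorGeneratedCMPointed_local_closed
    (hP : DivisorGeneratedCMPointedWeilFamiliesCMField) (hL : LocalWeilVHCAtCMField)
    (h24 : Deligne1982_hodgeRing_weilTypeCM_of_hodgeGroupSU) : HodgeGeneralWeilTypeCMField :=
  hodgeGeneralWeilTypeCMField_of_weilClassesCMField_closed h24 (HC_WeilClassesCMField_of_divisorGeneratedCMPointed_local hP hL)

/-- **Row T6-CM-germ WITHOUT `HC_CM`, closed form.** [cite: Gordon1997, Thm. 6.4] [cite: BuchweitzFlenner2003, §5 Thm. 5.1]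
[cite: Deligne1982HodgeCycles, §4 (4.4), Prop. 4.4, endnote 16] -/
theorem HC_GeneralWeilTypeCMField_of_divisorGeneratedCMPointed_of_semiregularChernLift_closed (C : ChernCharacterBetti)
    (hP : DivisorGeneratedCMPointedWeilFamiliesCMField) (hL : SemiregularChernLiftAtCMField C)
    (hBF : BuchweitzFlenner2003_variationalHodge_ISemiregular)
    (h24 : Deligne1982_hodgeRing_weilTypeCM_of_hodgeGroupSU) : HodgeGeneralWeilTypeCMField :=
  hodgeGeneralWeilTypeCMField_of_weilClassesCMField_closed h24
    (HC_WeilClassesCMField_of_divisorGeneratedCMPointed_of_semiregularChernLift C hP hL hBF)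

/-- **Position of row T6-CM in closed form** (kernel-checked conjunction): the class target is a case of `HC_AV`
(gen 5), is reached from R3 through fact #24 alone, and from `HC_CM` + one supply leaf + one transport leaf + #24.
[cite: Deligne1982HodgeCycles, §4 (4.4), Prop. 4.4, endnote 16] [cite: MoonenZarhin1998WeilClasses, §1] -/
theorem hodgeGeneralWeilTypeCMField_closed_position (C : ChernCharacterBetti) :
    (Theses.PadicSemiregularLift.HodgeAbelianVarieties → HodgeGeneralWeilTypeCMField) ∧
    (Deligne1982_hodgeRing_weilTypeCM_of_hodgeGroupSU → WeilClassesCMField → HodgeGeneralWeilTypeCMField) ∧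
    (Theses.RankFourFaces.CMAbelianHodge → CMPointedWeilFamiliesCMField → WeilVariationalHodgeCMField →
      Deligne1982_hodgeRing_weilTypeCM_of_hodgeGroupSU → HodgeGeneralWeilTypeCMField) ∧
    (Theses.RankFourFaces.CMAbelianHodge → CMPointedWeilFamiliesCMField → LocalWeilVHCAtCMField →
      Deligne1982_hodgeRing_weilTypeCM_of_hodgeGroupSU → HodgeGeneralWeilTypeCMField) ∧
    (Theses.RankFourFaces.CMAbelianHodge → CMPointedWeilFamiliesCMField → SemiregularChernLiftAtCMField C →
      BuchweitzFlenner2003_variationalHodge_ISemiregular → Deligne1982_hodgeRing_weilTypeCM_of_hodgeGroupSU →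
      HodgeGeneralWeilTypeCMField) :=
  ⟨hodgeGeneralWeilTypeCMField_of_hodgeAbelianVarieties, hodgeGeneralWeilTypeCMField_of_weilClassesCMField_closed,
    HC_GeneralWeilTypeCMField_of_HC_CM_closed, HC_GeneralWeilTypeCMField_of_HC_CM_local_closed,
    HC_GeneralWeilTypeCMField_of_HC_CM_of_semiregularChernLift_closed C⟩

/-! ## Audit: nothing is decided here — every theorem whose conclusion is the class target has among its hypotheses an
OPEN statement of ours (a supply leaf and a transport leaf, or R3 itself), the unformalised fact #24 (UNREFEREED ×2),
on the germ rows the refereed unformalised fact `BuchweitzFlenner2003_variationalHodge_ISemiregular`, and on the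
`HC_CM` rows `HC_CM` by name. Moonen–Zarhin's criterion and the descent input are THEOREMS and no longer appear.
Axiom closures: the three standard axioms only. -/

#print axioms Summit.HodgeConjecture.HodgeConjecture.Ring2Transport.hodgeConjectureFor_weilTypeCM_closed
#print axioms Summit.HodgeConjecture.HodgeConjecture.Ring2Transport.HC_GeneralWeilTypeCMField_of_HC_CM_closed
#print axioms Summit.HodgeConjecture.HodgeConjecture.Ring2Transport.HC_GeneralWeilTypeCMField_of_divisorGeneratedCMPointed_of_semiregularChernLift_closed

end Summit.HodgeConjecture.HodgeConjecture.Ring2Transport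

end
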